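import Summits.CriticalPhenomena.SAWScalingLimit.Theorems.SAWSpinMonotoneQCIdentificationXiRay
import Summits.CriticalPhenomena.SAWScalingLimit.Theorems.SAWSpinMonotoneQCIdentificationXiCycleStep
import Summits.CriticalPhenomena.SAWScalingLimit.Theorems.SAWSpinMonotoneQCIdentificationXiCycleSplit

/-!
# Smirnov's primitive `Ξ = F^{8/5} dz`, V: the single boundary cycle, and the whole boundary on
one ray (helper sub-goal (O) of `stub_rayCondition`, line `eight_fifths_primitive`, crux
`QCIdentification`, stmt-CriticalPhenomena-16772)

**What.**

* `xi_single_boundary_cycle` (registered): for a finite set `T` of faces of `𝕋` with connected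
  complement (`hexDomainSimplyConnected T`) which is connected in `ℍ`, every function `f` on ports
  `(v, k)` taking the same value on the two flank ports of every arc of `T` (arc
  `face s (j+1), …, face s (j+m)` of faces of `T` around a site `s`, flanks `face s j`,
  `face s (j+1+m)` outside `T`; out-flank port `(face s (j+1), arcCornerIdx (j+1) + 1)`, in-flank
  port `(face s (j+m), arcCornerIdx (j+m))`) is constant on the boundary ports of `T` (`v ∈ T`,
  `hexNbr v k ∉ T`): the boundary ports, linked by the arcs, form ONE cycle.
  *Proof* (`key_induction`): the stronger statement "flank condition at all arcs whose out-flank is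
  not a given port `p₀` ⇒ constancy" (a cycle minus one edge is connected) by strong induction on
  `|T|`, removing the topmost face `v` (maximal `2·x₁ + type`; its upper neighbours are outside `T`,
  so `T ∖ {v}` keeps a connected complement, `PotentialExists.simplyConnected_erase`): `v` is
  isolated (`const_of_isolated`), or a leaf (`xi_leaf_step`), or a down face with both lower
  neighbours in `T` — joined in `T ∖ {v}` (complete hexagon below `v`,
  `FacePot.fp_hexagon_complete_of_joined`; `joined_step`) or not (`v` a cut face, the two components
  `NB.srcComp` simply connected by `xi_srcComp_simplyConnected`; `xi_split_step`).
* `xi_boundary_all_one_ray` (registered): consequently, under `NoFoldBound`, for a simply connected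
  `Λ` with boundary source `{ua, va}`, with the lifted argument `Θ` of `xi_boundary_ray_package`
  the boundary phase `bdPhase` vanishes at EVERY boundary port of the source component
  `Λ₀ = NB.srcComp Λ va` (it is preserved across arcs, `xi_phase_step`, vanishes at the source, and
  `Λ₀` is connected and simply connected), so every boundary increment of `Ξ` on `Λ₀` other than the
  source equals `‖Ξ‖ e^{i(π/2 + arg (c(va) - c(ua)))}` with `‖Ξ‖ > 0`: the whole boundary lies on the
  one ray `i (c(va) - c(ua)) ℝ_{>0}` — part (O) of the stub report, closing the lattice side of
  Smirnov's primitive package.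

Sources: S. Smirnov, *Towards conformal invariance of 2D lattice models*, Proc. ICM 2006
(arXiv:0708.0032) §5.6; H. Duminil-Copin, S. Smirnov, Ann. of Math. 175 (2012) 1653–1665
(arXiv:1007.0575), §3; stub report `STUB-REPORT-rayCondition.md` ((O)) of this line.  The single
cycle was validated by enumeration (`work/stubs/scratch_xi/cycle_check.py`, 306 face sets;
`cycle_induction_check.py`, 2 859 face sets through all induction cases).
-/

noncomputable section

open Complex
open Literature.Probability.LatticeModels Literature.Probability.RandomPlanarGeometry
open Literature.Probability.RandomPlanarGeometry.SAW
open Literature.Barriers.CriticalPhenomena Literature.Barriers.CriticalPhenomena.HexKernel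
open Summit.CriticalPhenomena.SAWScalingLimit.Theses.SAWDevelopingMap
open Summit.CriticalPhenomena.SAWScalingLimit.Theorems.PotentialExists (simplyConnected_erase)

namespace Summit.CriticalPhenomena.SAWScalingLimit.Cruxes.QCIdentification.EightFifthsPrimitive

namespace Xi

open NB Dev P85 Stokes
open Literature.Probability.Percolation.TriMarkedDomain (fin3_add_one_add_one fin3_add_two_add_one)

/-! ### The induction -/

/-- **The single boundary cycle, strong form.** For a finite face set `T` with connected
complement, connected in `ℍ`: if `f` satisfies the flank condition at every arc of `T` whose
out-flank port is not `p₀`, then `f` is constant on the boundary ports of `T`. -/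
theorem key_induction (n : ℕ) : ∀ (T : Finset HexVertex), T.card = n → hexDomainSimplyConnected T →
    (hexGraph.induce (↑T : Set HexVertex)).Preconnected →
    ∀ (f : HexVertex → Fin 3 → ℝ) (p₀ : HexVertex × Fin 3),
      (∀ (s : Site 2) (j m : Fin 6), m ≠ 0 → face s j ∉ T →
        (∀ i : Fin 6, i < m → face s (j + 1 + i) ∈ T) → face s (j + 1 + m) ∉ T →
        (face s (j + 1), arcCornerIdx (j + 1) + 1) ≠ p₀ →
        f (face s (j + 1)) (arcCornerIdx (j + 1) + 1) = f (face s (j + m)) (arcCornerIdx (j + m))) →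
      ∀ (x y : HexVertex) (k k' : Fin 3), x ∈ T → hexNbr x k ∉ T → y ∈ T → hexNbr y k' ∉ T →
        f x k = f y k' := by
  induction n using Nat.strong_induction_on with
  | _ n ihn =>
  intro T hcard hsc hconn f p₀ hL
  have IH : ∀ X : Finset HexVertex, X.card < T.card → hexDomainSimplyConnected X →
      (hexGraph.induce (↑X : Set HexVertex)).Preconnected →
      ∀ (f' : HexVertex → Fin 3 → ℝ) (p' : HexVertex × Fin 3),
        (∀ (s : Site 2) (j m : Fin 6), m ≠ 0 → face s j ∉ X →
          (∀ i : Fin 6, i < m → face s (j + 1 + i) ∈ X) → face s (j + 1 + m) ∉ X →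
          (face s (j + 1), arcCornerIdx (j + 1) + 1) ≠ p' →
          f' (face s (j + 1)) (arcCornerIdx (j + 1) + 1) = f' (face s (j + m)) (arcCornerIdx (j + m))) →
        ∀ (x y : HexVertex) (k k' : Fin 3), x ∈ X → hexNbr x k ∉ X → y ∈ X → hexNbr y k' ∉ X →
          f' x k = f' y k' :=
    fun X hX hXsc hXc => ihn X.card (hcard ▸ hX) X rfl hXsc hXc
  suffices H : ∃ c : ℝ, ∀ (x : HexVertex) (k : Fin 3), x ∈ T → hexNbr x k ∉ T → f x k = c by
    obtain ⟨c, hc⟩ := H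
    intro x y k k' hx hxk hy hyk
    rw [hc x k hx hxk, hc y k' hy hyk]
  rcases T.eq_empty_or_nonempty with rfl | hne
  · exact ⟨0, fun x k hx => by simp at hx⟩
  obtain ⟨v, hv, hmax⟩ :=
    Finset.exists_max_image T (fun q : HexVertex => 2 * q.1 1 + ((q.2 : ℕ) : ℤ)) hne
  have hcard' : (T.erase v).card < T.card := Finset.card_erase_lt_of_mem hv
  -- the induction hypothesis for `T ∖ {v}`, given connectivity
  have IH' : (hexGraph.induce (↑(T.erase v) : Set HexVertex)).Preconnected →
      ∀ k : Fin 3, hexNbr v k ∉ T → ∀ (f' : HexVertex → Fin 3 → ℝ) (p' : HexVertex × Fin 3),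
        (∀ (s : Site 2) (j m : Fin 6), m ≠ 0 → face s j ∉ T.erase v →
          (∀ i : Fin 6, i < m → face s (j + 1 + i) ∈ T.erase v) → face s (j + 1 + m) ∉ T.erase v →
          (face s (j + 1), arcCornerIdx (j + 1) + 1) ≠ p' →
          f' (face s (j + 1)) (arcCornerIdx (j + 1) + 1) = f' (face s (j + m)) (arcCornerIdx (j + m))) →
        ∀ (x y : HexVertex) (k k' : Fin 3), x ∈ T.erase v → hexNbr x k ∉ T.erase v →
          y ∈ T.erase v → hexNbr y k' ∉ T.erase v → f' x k = f' y k' :=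
    fun hc k hk => IH _ hcard' (simplyConnected_erase hsc hk (adj_hexNbr v k)) hc
  -- a leaf keeps `T ∖ {v}` connected
  have hleaf : ∀ a : Fin 3, hexNbr v a ∉ T → hexNbr v (a + 1) ∉ T →
      (hexGraph.induce (↑(T.erase v) : Set HexVertex)).Preconnected := by
    intro a ha ha1
    refine preconnected_erase_of hv hconn fun k k' hk hk' => ?_
    have e : ∀ k : Fin 3, hexNbr v k ∈ T.erase v → k = a + 2 := by
      intro k hk
      rcases fin3_trichotomy a k with rfl | rfl | rfl
      · exact absurd (Finset.mem_of_mem_erase hk) ha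
      · exact absurd (Finset.mem_of_mem_erase hk) ha1
      · rfl
    obtain rfl := e k hk
    obtain rfl := e k' hk'
    rfl
  -- an isolated `v`
  have hisol : (∀ k : Fin 3, hexNbr v k ∉ T) →
      ∃ c : ℝ, ∀ (x : HexVertex) (k : Fin 3), x ∈ T → hexNbr x k ∉ T → f x k = c := by
    intro hall
    refine ⟨f v 0, fun y k hy _ => ?_⟩
    obtain rfl := eq_of_isolated hv hconn hall hy
    exact const_of_isolated hL hv hall k
  obtain ⟨x, t⟩ := v
  fin_cases t
  · -- up face `(x, 0)`: the two upper neighbours (ports `0`, `1`) are outside `T`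
    simp only [Fin.zero_eta] at hv hmax IH' hleaf hisol ⊢
    have h0 : hexNbr (x, 0) 0 ∉ T := fun h => by have := hmax _ h; simp [hexNbr] at this
    have h1 : hexNbr (x, 0) 1 ∉ T := fun h => by have := hmax _ h; simp [hexNbr] at this
    by_cases h2 : hexNbr (x, 0) 2 ∈ T
    · exact ⟨_, xi_leaf_step hv h0 h1 h2 hL (IH' (hleaf 0 h0 h1) 0 h0)⟩
    · refine hisol fun k => ?_
      fin_cases k <;> assumption
  · -- down face `(x, 1)`: the upper neighbour (port `2`) is outside `T`
    simp only [Fin.mk_one] at hv hmax IH' hleaf hisol ⊢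
    have h2 : hexNbr (x, 1) 2 ∉ T := fun h => by
      have := hmax _ h
      simp [hexNbr] at this
      omega
    by_cases h0 : hexNbr (x, 1) 0 ∈ T <;> by_cases h1 : hexNbr (x, 1) 1 ∈ T
    · -- both lower neighbours in `T`
      have hS : face (x + unitE0) 1 = (x, 1) := by simp [face]
      have hκ : arcCornerIdx 1 = 0 := rfl
      have h0' : hexNbr (x, 1) 0 ∈ T.erase (x, 1) :=
        Finset.mem_erase.2 ⟨(adj_hexNbr (x, 1) 0).ne', h0⟩
      have h1' : hexNbr (x, 1) 1 ∈ T.erase (x, 1) :=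
        Finset.mem_erase.2 ⟨(adj_hexNbr (x, 1) 1).ne', h1⟩
      by_cases hj : (hexGraph.induce (↑(T.erase (x, 1)) : Set HexVertex)).Reachable
          ⟨hexNbr (x, 1) 0, Finset.mem_coe.2 h0'⟩ ⟨hexNbr (x, 1) 1, Finset.mem_coe.2 h1'⟩
      · -- joined: the hexagon below `v` is complete
        have hfull : ∀ j : Fin 6, face (x + unitE0) j ∈ T := by
          refine FacePot.fp_hexagon_complete_of_joined T hsc x hv (by simpa [hexNbr] using h2) ?_
          obtain ⟨p⟩ := hj
          have h := reflTransGen_of_walk _ _ p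
          simpa [hexNbr] using h
        have hc : (hexGraph.induce (↑(T.erase (x, 1)) : Set HexVertex)).Preconnected := by
          refine preconnected_erase_of hv hconn fun k k' hk hk' => ?_
          have e : ∀ (k : Fin 3) (hk : hexNbr (x, 1) k ∈ T.erase (x, 1)),
              (hexGraph.induce (↑(T.erase (x, 1)) : Set HexVertex)).Reachable
                ⟨hexNbr (x, 1) 0, Finset.mem_coe.2 h0'⟩ ⟨hexNbr (x, 1) k, Finset.mem_coe.2 hk⟩ := by
            intro k hk
            fin_cases k
            · exact SimpleGraph.Reachable.refl _
            · exact hj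
            · exact absurd (Finset.mem_of_mem_erase hk) h2
          exact (e k hk).symm.trans (e k' hk')
        exact ⟨_, joined_step (a := 0) hv h0 h1 h2 hS hκ hfull hL (IH' hc 2 h2)⟩
      · -- not joined: `v` is a cut face
        have hsc' : hexDomainSimplyConnected (T.erase (x, 1)) :=
          simplyConnected_erase hsc h2 (adj_hexNbr _ 2)
        refine ⟨_, xi_split_step (a := 0) hv h0 h1 h2 hS hκ hL hconn (fun _ _ => hj) fun b _ => ?_⟩
        refine IH _ (lt_of_le_of_lt (Finset.card_le_card fun y hy => srcComp_subset hy) hcard')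
          (xi_srcComp_simplyConnected hsc' _) (srcComp_preconnected _ _)
    · -- only `hexNbr v 0 ∈ T`: a leaf with outer ports `1`, `2`
      exact ⟨_, xi_leaf_step (a := 1) hv h1 h2 h0 hL (IH' (hleaf 1 h1 h2) 2 h2)⟩
    · -- only `hexNbr v 1 ∈ T`: a leaf with outer ports `2`, `0`
      exact ⟨_, xi_leaf_step (a := 2) hv h2 h0 h1 hL (IH' (hleaf 2 h2 h0) 2 h2)⟩
    · refine hisol fun k => ?_
      fin_cases k <;> assumption

/-! ### The single boundary cycle -/

/-- **Single boundary cycle (registered).** For a finite set `T` of faces of `𝕋` with connected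
complement (`hexDomainSimplyConnected T`) which is itself connected in `ℍ`, every function `f` on
ports `(v, k)` that takes the same value on the two flank ports of every arc of `T` (arc
`face s (j+1), …, face s (j+m)` of faces of `T` around a site `s`, `m ≠ 0`, flanks `face s j`,
`face s (j+1+m)` outside `T`; out-flank port `(face s (j+1), arcCornerIdx (j+1) + 1)`, in-flank port
`(face s (j+m), arcCornerIdx (j+m))`) is constant on the boundary ports of `T`
(`v ∈ T`, `hexNbr v k ∉ T`). -/
theorem xi_single_boundary_cycle : ∀ (T : Finset HexVertex), hexDomainSimplyConnected T → (hexGraph.induce (↑T : Set HexVertex)).Preconnected → ∀ (f : HexVertex → Fin 3 → ℝ), (∀ (s : Site 2) (j m : Fin 6), m ≠ 0 → HexKernel.face s j ∉ T → (∀ i : Fin 6, i < m → HexKernel.face s (j + 1 + i) ∈ T) → HexKernel.face s (j + 1 + m) ∉ T → f (HexKernel.face s (j + 1)) (arcCornerIdx (j + 1) + 1) = f (HexKernel.face s (j + m)) (arcCornerIdx (j + m))) → ∀ (v w : HexVertex) (k k' : Fin 3), v ∈ T → hexNbr v k ∉ T → w ∈ T → hexNbr w k' ∉ T → f v k = f w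 k' := by
  intro T hsc hconn f hf v w k k' hv hvk hw hwk
  exact key_induction T.card T rfl hsc hconn f (v, k)
    (fun s j m hm hj hi hjm _ => hf s j m hm hj hi hjm) v w k k' hv hvk hw hwk

/-! ### The whole boundary of the source component on one ray -/

variable {Λ : Finset HexVertex} {ua va : HexVertex}

/-- **The whole boundary of the source component on one ray (registered).** Under `NoFoldBound`,
for a simply connected `Λ` with boundary source `{ua, va}` (`va ∈ Λ`, `ua ∉ Λ`, adjacent) there is a
lifted argument `Θ` (increments `arg (S_w/S_v)` across adjacent faces of the source component
`Λ₀ = NB.srcComp Λ va`, `Θ ≡ arg S (mod 2π)` on `Λ₀`) such that at EVERY boundary port `(v, k)` of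
`Λ₀` the boundary phase vanishes, and at every such port other than the source the increment
`Ξ(v, k) = dXi F Θ v k` equals `‖Ξ‖ e^{i(π/2 + arg (c(va) - c(ua)))}` with `‖Ξ‖ > 0`. -/
theorem xi_boundary_all_one_ray : NoFoldBound → ∀ {Λ : Finset HexVertex}, hexDomainSimplyConnected Λ → ∀ {ua va : HexVertex}, va ∈ Λ → ua ∉ Λ → hexGraph.Adj va ua → ∃ Θ : HexVertex → ℝ, (∀ v ∈ NB.srcComp Λ va, ∀ w ∈ NB.srcComp Λ va, hexGraph.Adj v w → Θ w - Θ v = Complex.arg (modeSum (Fobs Λ s(ua, va)) w / modeSum (Fobs Λ s(ua, va)) v)) ∧ (∀ v ∈ NB.srcComp Λ va, (Θ v : Real.Angle) = Complex.arg (modeSum (Fobs Λ s(ua, va)) v)) ∧ (∀ v ∈ NB.srcComp Λ va, ∀ k : Fin 3, hexNbr v k ∉ Λ → Xi.bdPhase Λ s(ua, va) Θ v k = 0) ∧ (∀ v ∈ NB.srcComp Λ va, ∀ k : Fin 3, hexNbr v k ∉ Λ → s(hexNbr v k, v) ≠ s(ua, va) → Xi.dXi (Fobs Λ s(ua, va))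 Θ v k = (‖Xi.dXi (Fobs Λ s(ua, va)) Θ v k‖ : ℂ) * Complex.exp ((Real.pi / 2 + Complex.arg (hexCenter va - hexCenter ua) : ℝ) * Complex.I) ∧ 0 < ‖Xi.dXi (Fobs Λ s(ua, va)) Θ v k‖) := by
  intro hK Λ hΛ ua va hva hua hadj
  obtain ⟨Θ, hinc, hang, hsrc, hstep, hray⟩ := xi_boundary_ray_package hK hΛ hva hua hadj
  have hva0 : va ∈ srcComp Λ va := mem_srcComp_iff.2 ⟨hva, hva, SimpleGraph.Reachable.refl _⟩
  obtain ⟨ka, hka⟩ := exists_hexNbr_eq hadj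
  -- the arc condition on the source component
  have harc : ∀ (s : Site 2) (j m : Fin 6), m ≠ 0 → face s j ∉ srcComp Λ va →
      (∀ i : Fin 6, i < m → face s (j + 1 + i) ∈ srcComp Λ va) → face s (j + 1 + m) ∉ srcComp Λ va →
      bdPhase Λ s(ua, va) Θ (face s (j + 1)) (arcCornerIdx (j + 1) + 1) =
        bdPhase Λ s(ua, va) Θ (face s (j + m)) (arcCornerIdx (j + m)) := by
    intro s j m hm hout hin hout'
    have h0 : (0 : Fin 6) < m := (Fin.pos_iff_ne_zero' m).2 hm
    have hl : m - 1 < m := Fin.sub_one_lt_iff.2 h0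
    have e : j + 1 + (m - 1) = j + m := by abel
    have hv0 : face s (j + 1) ∈ srcComp Λ va := by simpa using hin 0 h0
    have hv1 : face s (j + m) ∈ srcComp Λ va := by have h := hin (m - 1) hl; rwa [e] at h
    have houtΛ : face s j ∉ Λ :=
      not_mem_of_not_mem_srcComp hv0 (by simpa using StepLaw.adj_face_pred s (j + 1)) hout
    have hout'Λ : face s (j + 1 + m) ∉ Λ := by
      have h := StepLaw.adj_face_succ s (j + m)
      rw [show j + m + 1 = j + 1 + m by abel] at h
      exact not_mem_of_not_mem_srcComp hv1 h hout'
    exact hstep s j m hm houtΛ (fun i hi => srcComp_subset (hin i hi)) hout'Λ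
      (fun i hi => modeSum_ne_zero_of_mem_srcComp hK hΛ hua hadj (hin i hi))
  have hconst := xi_single_boundary_cycle (srcComp Λ va) (xi_srcComp_simplyConnected hΛ va)
    (srcComp_preconnected Λ va) (bdPhase Λ s(ua, va) Θ) harc
  have hzero : ∀ v ∈ srcComp Λ va, ∀ k : Fin 3, hexNbr v k ∉ Λ → bdPhase Λ s(ua, va) Θ v k = 0 := by
    intro v hv k hu
    rw [hconst v va k ka hv (fun h => hu (srcComp_subset h)) hva0
      (fun h => hua (srcComp_subset (hka ▸ h))), hsrc ka hka]
  refine ⟨Θ, hinc, hang, hzero, fun v hv k hu hne => ?_⟩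
  exact hray v k (srcComp_subset hv) hu (modeSum_ne_zero_of_mem_srcComp hK hΛ hua hadj hv) hne
    (hzero v hv k hu)

end Xi

end Summit.CriticalPhenomena.SAWScalingLimit.Cruxes.QCIdentification.EightFifthsPrimitive

end
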